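import Summits.HodgeConjecture.HodgeConjecture.Theorems.F0P3cStCharTSPs2Kind3       -- ★ p851400 (LH6-p03 g4) «PS2-KIND3★» `ps2_kind3_of_fields`; brings ★ LdsFields (S5), ★ `Ch12Sec5Inputs` ((LDS) `LdsNotL2`), ★ `Ch12Sec5Defs` (`IsEllipticPair`, `IsL2`), ★ `KeysCaseTwoLabels`
import HarnessLib

/-!
# F0 · P3c · line LH6 «StCharTS» — datum road «PS2-ASSEMBLY★» (+ «PS2-KIND1★»): THE PAIR-CURRENCY CONJUNCT (PS2) OF THE (S-𝔇) PACKAGE ASSEMBLED FROM ITS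
# THREE KINDS — kind 1 (l.d.s. pairs) is VACUOUS by (LDS), kind 2 (`{St_G(ψ), ψ∘det_G}`) is the S4b core (hypothesis), kind 3 (`{π²(ξ′), πⁿ(ξ′)}`) is ★ «PS2-KIND3★»

Cell `hodgecm-mathlib`, crux `H413` (`stmt-HodgeConjecture-24833`), line LH6 `Cruxes/H413/Lines/F0_P3c_StCharTSPaydown.lean` (organ (S-𝔇) `stub_EllipticPackage`; its
conjunct (PS2) «`∀ π σ, ¬ 𝔇.IsL2 π → 𝔇.IsL2 σ → 𝔇.IsEllipticPair π σ → ∀ f, IsLocSmooth f → π.smoothTrace νQv f + σ.smoothTrace νQv f = Representation.smoothTrace (G :=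
Gqs L v) (cmPrincipalSeries L 3 v (cmTorusCharPair L v (par π).1 (par π).2)) νQv f`» = hypothesis `hPS2` of ★ «DATUM-JUNCTION v2»
`F0P3cStCharTSDatumJunction.ellipticPackage_body_of_inputs` (p851346), TOKEN FOR TOKEN).  Seat LH6-p02 (g5); slices «PS2-KIND1★» ∕ «PS2-ASSEMBLY» (offered
2026-09-02T12:28Z, «=» LH6-p03 (g4) 12:43:16Z as S7-part-2 owner).  THEOREMS ONLY (no `def`, no named fact, no `instance`, no notation, no `sorry`; axioms ⊆ {propext,
Classical.choice, Quot.sound}); `--supports stmt-HodgeConjecture-24833` (helper).  HONEST LABEL: HC_CM is proved only modulo the 7 printed citations (2 remaining: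
hLiu418 = stmt-HodgeConjecture-24832, h413 = stmt-HodgeConjecture-24833) until rung 0 closes; count-neutral (no leaf edition is implied; at the junction this file turns
the NAMED input `hPS2` into: the socket (LDS) (★ S5), the socket (ST-L2) (★ S4b), the FIELD hypotheses `hKeys` (★ S6∕S6b) + the Keys-labels clause (★ XI-DICT ED. 2
(e), LH6-p03 (g4)), (NONL2-PAR) `hNL` (★ S7), and ONE remaining hypothesis `hK2` = the kind-2 core «`Tr ψ∘det_G + Tr St_G(ψ) = Tr i_G(par (ψ∘det_G))`» (S4b hands,
F0P2-p06 (g17), in flight)).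

THE MATHEMATICS ([Rogawski1990, §12.6 Prop. 12.6.1 (b) p. 188: the three kinds of pairs `{π, π′}` — an l.d.s. `L`-packet, `{St_G(ψ), ψ∘det}`, `{π²(ξ), πⁿ(ξ)}`;
§12.7 L. 12.7.2 (proof) p. 192: for the last two kinds with `π` the non-square-integrable member, `χ_π + χ_{π′} = χ_{i_G(χ)}`]).  (PS2) quantifies over `π` NOT
square-integrable and `σ` square-integrable.  KIND 1: `σ` lies in an l.d.s. packet, whose members are NOT square-integrable ((LDS), ★ S5 — Casselman's criterion at
the unitary exponent): the case is EMPTY.  KIND 2: `π = St_G(ψ)` is excluded by (ST-L2) (★ S4b: `St_G(ψ)` IS square-integrable), so `π = ψ∘det_G`, `σ = St_G(ψ)` and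
the identity is the kind-2 core `hK2`.  KIND 3: ★ `F0P3cStCharTSPs2Kind3.ps2_kind3_of_fields` (orientation forced by `hKeys`, labels by the Keys-labels clause, the
principal series `i_G(par π)` located by ★ CUSP-SUPPORT, additivity over the labelled pair).

* §1 «PS2-KIND1★» `not_isL2_of_ldsPair` ∕ `ps2_kind1_absurd` — an l.d.s. pair has no square-integrable member (so kind 1 of (PS2) is vacuous), over the socket (LDS).
* §2 «PS2-ASSEMBLY» `ps2_of_kinds` — (PS2) VERBATIM at the datum `𝔇` from: COMPAT `hC03 : 𝔇.μGZ = μZ`, (LDS) `hLDS : 𝔇.LdsNotL2`, (ST-L2) `hStL2` (the junction's text),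
  the kind-2 core `hK2`, `hKeys` (the junction's text), the Keys-labels clause `hlabels` (★ XI-DICT ED. 2 (e)'s text, generic `μv`), and (NONL2-PAR) `hNL` (the
  junction's text) — for every measure `νQv` finite on compacts.

## References
* [Rogawski1990] J. D. Rogawski, *Automorphic Representations of Unitary Groups in Three Variables*, Ann. of Math. Stud. 123 (1990): §12.2 pp. 173–174 (the three
  reducibility cases of `i_G(χ)` [Keys]); §12.6 Prop. 12.6.1 (b) p. 188; §12.7 L. 12.7.2 (proof) p. 192.
* [Keys1984] D. Keys, *Principal series representations of special unitary groups over local fields*, Compositio Math. 51 (1984), §7 Thm. p. 126.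
* [Casselman1995] W. Casselman, *Introduction to the theory of admissible representations of p-adic reductive groups* (1974∕1995): Thm. 4.4.6 (square-integrability
  criterion), Cor. 6.3.9 (b), Cor. 7.1.2.
-/

set_option autoImplicit false
-- the mandated namespace has the single-problem summit's repeated segment (`HodgeConjecture.HodgeConjecture`)
set_option linter.dupNamespace false

noncomputable section

open NumberField IsDedekindDomain MeasureTheory
open scoped Matrix

open Literature.NumberTheory.Rogawski1990 Literature.NumberTheory.Automorphic Literature.NumberTheory.Automorphic.UnitaryGroup

namespace Summit.HodgeConjecture.HodgeConjecture.Cruxes.H413.F0P3cStCharTSPs2Assembly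

/-! ## §1 «PS2-KIND1★» — an l.d.s. pair has no square-integrable member -/

section Kind1

variable {G H : Type} [Group G] [TopologicalSpace G] [IsTopologicalGroup G] [MeasurableSpace G]
  [∀ γ : G, MeasurableSpace (G ⧸ Subgroup.centralizer ({γ} : Set G))] [MeasurableSpace (G ⧸ Subgroup.center G)]
  [Group H] [TopologicalSpace H] [IsTopologicalGroup H] [MeasurableSpace H]

/-- **«PS2-KIND1★» (generic datum)**: under the socket (LDS) «l.d.s. members are not square-integrable» (★ `EllipticData.LdsNotL2`, in-house at the `U(Φ₃)(L⁺_v)` datum by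
★ S5 `F0P3cStCharTSLdsFields.lds_sockets_of_ldsFields`), a pair `{π, σ}` that IS an l.d.s. packet (the FIRST kind of ★ `IsEllipticPair`, unfolded) has `σ` NOT square-integrable.
[cite: Rogawski1990, §12.2 (3) p. 174; §12.6 Prop. 12.6.1 (b) p. 188] [cite: Casselman1995, Thm. 4.4.6] -/
theorem not_isL2_of_ldsPair (𝔇 : Ch12Sec5.EllipticData G H) (hLDS : 𝔇.LdsNotL2) {π σ : IrrClass G}
    (hkind : ∃ P ∈ 𝔇.ldsPackets, ∀ τ : IrrClass G, τ ∈ P ↔ (τ = π ∨ τ = σ)) : ¬ 𝔇.IsL2 σ := by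
  obtain ⟨P, hP, hmem⟩ := hkind
  exact hLDS P hP σ ((hmem σ).2 (Or.inr rfl))

/-- **«PS2-KIND1★» — kind 1 of (PS2) is VACUOUS**: there is no l.d.s. pair `{π, σ}` with `σ` square-integrable (so any conclusion follows). Under (LDS).
[cite: Rogawski1990, §12.2 (3) p. 174; §12.6 Prop. 12.6.1 (b) p. 188] -/
theorem ps2_kind1_absurd (𝔇 : Ch12Sec5.EllipticData G H) (hLDS : 𝔇.LdsNotL2) {π σ : IrrClass G} (hσ : 𝔇.IsL2 σ)
    (hkind : ∃ P ∈ 𝔇.ldsPackets, ∀ τ : IrrClass G, τ ∈ P ↔ (τ = π ∨ τ = σ)) {C : Prop} : C :=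
  absurd hσ (not_isL2_of_ldsPair 𝔇 hLDS hkind)

end Kind1

/-! ## §2 «PS2-ASSEMBLY» — (PS2) at the datum from its three kinds -/

section Datum

variable {L : Type} [Field L] [NumberField L] [IsCMField L] {v : HeightOneSpectrum (𝓞 ↥(maximalRealSubfield L))}

set_option synthInstance.maxHeartbeats 400000 in
set_option maxHeartbeats 16000000 in
-- statement-heavy: (NONL2-PAR), the kind-2 core and the conclusion each quote `IsConstituentOf ∕ smoothTrace (cmPrincipalSeries …)` on classes of `Gqs L v` (class of ★ PS2-KIND3 §2)
/-- **«PS2-ASSEMBLY» — the conjunct (PS2) of (S-𝔇) TOKEN FOR TOKEN at the datum `𝔇`** (= hypothesis `hPS2` of ★ `F0P3cStCharTSDatumJunction.ellipticPackage_body_of_inputs`), for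
every measure `νQv` finite on compacts, FROM: COMPAT `hC03 : 𝔇.μGZ = μZ`; the socket (LDS) `hLDS` (★ S5); the socket (ST-L2) `hStL2` (the junction's text; ★ S4b
`F0P3cStCharTSStField.stL2_of_stField`); the KIND-2 CORE `hK2` «for continuous `ψ` with `ψ∘det_G` not square-integrable, `Tr ψ∘det_G(f) + Tr St_G(ψ)(f) = Tr i_G(par (ψ∘det_G))(f)`»
(S4b hands); the field hypothesis `hKeys` (the junction's text, ★ S6∕S6b) and the Keys-labels clause `hlabels` at a quadratic-extension character `μv` (★ XI-DICT ED. 2 clause (e),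
with `μv := μ.semilocalComponent L v`); (NONL2-PAR) `hNL` (the junction's text, ★ S7).  Kind 1 is vacuous (§1), kind 2 is `hK2` after (ST-L2) forces the orientation, kind 3 is ★
`F0P3cStCharTSPs2Kind3.ps2_kind3_of_fields`. [cite: Rogawski1990, §12.6 Prop. 12.6.1 (b) p. 188; §12.7 L. 12.7.2 (proof) p. 192; §12.2 pp. 173–174] [cite: Keys1984, §7 Thm. p. 126] -/
theorem ps2_of_kinds
    (hns : ∀ w : PlacesOver L v, IsCMField.complexConj L • w.1 = w.1)
    (μv : (UnitaryGroup.LocalRing L v)ˣ →* ℂˣ) (hμ : IsQuadraticCharExtension (conjLocal L (IsCMField.complexConj L) v) μv)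
    (hμc : Continuous (fun x => ((μv x : ℂˣ) : ℂ)))
    [MeasurableSpace (Gqs L v)] [BorelSpace (Gqs L v)]
    [∀ γ : Gqs L v, MeasurableSpace (Gqs L v ⧸ Subgroup.centralizer ({γ} : Set (Gqs L v)))]
    [MeasurableSpace (Gqs L v ⧸ Subgroup.center (Gqs L v))]
    (μZ : Measure (Gqs L v ⧸ Subgroup.center (Gqs L v)))
    {H : Type} [Group H] [TopologicalSpace H] [IsTopologicalGroup H] [MeasurableSpace H]
    (𝔇 : Ch12Sec5.EllipticData (Gqs L v) H) (hC03 : 𝔇.μGZ = μZ)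
    (hLDS : 𝔇.LdsNotL2)
    (hStL2 : ∀ ψ' : ↥(Subgroup.center (Gqs L v)) →* ℂˣ, Continuous ψ' → 𝔇.IsL2 (𝔇.stG ψ'))
    (hKeys : ∀ ξ' : H →* ℂˣ, (𝔇.pi2 ξ').IsSquareIntegrable 𝔇.μGZ ∧ ¬ (𝔇.piN ξ').IsSquareIntegrable 𝔇.μGZ)
    (hlabels : ∀ ξ' : H →* ℂˣ, Continuous ξ' →
      ∃ (η₁ η₂ : ↥(normOneUnits (conjLocal L (IsCMField.complexConj L) v)) →* ℂˣ),
        Continuous (fun x => ((η₁ x : ℂˣ) : ℂ)) ∧ Continuous (fun x => ((η₂ x : ℂˣ) : ℂ)) ∧ KeysCaseTwoLabels L v μv η₁ η₂ (𝔇.pi2 ξ') (𝔇.piN ξ'))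
    (par : IrrClass (Gqs L v) → ((UnitaryGroup.LocalRing L v)ˣ →* ℂˣ) × (↥(normOneUnits (conjLocal L (IsCMField.complexConj L) v)) →* ℂˣ))
    (hNL : ∀ π : IrrClass (Gqs L v), ¬ π.IsSquareIntegrable μZ →
      π.IsConstituentOf (UnitaryGroup.cmPrincipalSeries L 3 v (UnitaryGroup.cmTorusCharPair L v (par π).1 (par π).2)) ∧ Continuous (par π).1 ∧ Continuous (par π).2)
    (νQv : Measure (Gqs L v)) [IsFiniteMeasureOnCompacts νQv]
    (hK2 : ∀ ψ' : ↥(Subgroup.center (Gqs L v)) →* ℂˣ, Continuous ψ' → ¬ 𝔇.IsL2 (𝔇.detG ψ') → ∀ f : Gqs L v → ℂ, IsLocSmooth f →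
      (𝔇.detG ψ').smoothTrace νQv f + (𝔇.stG ψ').smoothTrace νQv f =
        Representation.smoothTrace (G := Gqs L v) (UnitaryGroup.cmPrincipalSeries L 3 v (UnitaryGroup.cmTorusCharPair L v (par (𝔇.detG ψ')).1 (par (𝔇.detG ψ')).2)) νQv f) :
    ∀ π σ : IrrClass (Gqs L v), ¬ 𝔇.IsL2 π → 𝔇.IsL2 σ → 𝔇.IsEllipticPair π σ → ∀ f : Gqs L v → ℂ, IsLocSmooth f →
      π.smoothTrace νQv f + σ.smoothTrace νQv f =
        Representation.smoothTrace (G := Gqs L v) (UnitaryGroup.cmPrincipalSeries L 3 v (UnitaryGroup.cmTorusCharPair L v (par π).1 (par π).2)) νQv f := by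
  intro π σ hπ hσ hpair f hf
  rcases hpair with hk1 | ⟨ψ', hψ', hk2⟩ | ⟨ξ', hξ', hk3⟩
  · -- kind 1: vacuous
    exact ps2_kind1_absurd 𝔇 hLDS hσ hk1
  · -- kind 2: `π = St_G(ψ)` is square-integrable — excluded; so `π = ψ∘det_G`, `σ = St_G(ψ)`
    rcases hk2 with ⟨hπe, -⟩ | ⟨hπe, hσe⟩
    · exact absurd (hπe ▸ hStL2 ψ' hψ') hπ
    · rw [hπe, hσe]
      rw [hπe] at hπ
      exact hK2 ψ' hψ' hπ f hf
  · -- kind 3: ★ «PS2-KIND3★» at the datum's fields, in the `μZ` currency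
    have hπ' : ¬ π.IsSquareIntegrable μZ := fun h => hπ (show IrrClass.IsSquareIntegrable 𝔇.μGZ π by rw [hC03]; exact h)
    have hσ' : σ.IsSquareIntegrable μZ := by
      have h : IrrClass.IsSquareIntegrable 𝔇.μGZ σ := hσ
      rw [hC03] at h
      exact h
    have hL2 : ∀ ξ : H →* ℂˣ, (𝔇.pi2 ξ).IsSquareIntegrable μZ ∧ ¬ (𝔇.piN ξ).IsSquareIntegrable μZ := fun ξ => by
      have h := hKeys ξ
      rw [hC03] at h
      exact h
    exact F0P3cStCharTSPs2Kind3.ps2_kind3_of_fields hns μv hμ hμc μZ 𝔇.pi2 𝔇.piN hL2 hlabels par hNL νQv π σ hπ' hσ' ξ' hξ' hk3 f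

end Datum

end Summit.HodgeConjecture.HodgeConjecture.Cruxes.H413.F0P3cStCharTSPs2Assembly

end
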